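import Literature.NumberTheory.FaltingsSerre.ParamodularBridge
import HarnessLib

/-!
# `N = 277`: the abelian surface of conductor 277 is paramodular away from 277, from the
# reproduced Brumer–Pacetti–Poor–Tornaría–Voight–Yuen certificate

[BPPTVY] = A. Brumer, A. Pacetti, C. Poor, G. Tornaría, J. Voight, D. S. Yuen, *On the paramodularity of
typical abelian surfaces*, Algebra & Number Theory **13**:5 (2019) 1145–1195, Theorem 7.1.3 and
Lemma 7.1.4, pp. 1187–1188 [cite: BrumerEtAl2019] (PRINTED numbering).

`paramodular_277` is the INSTANCE at `N = 277` of the kernel-checked assembly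
`Literature.NumberTheory.FaltingsSerre.isParamodularAwayFrom_of_certificate`, with the sets of the
criterion pinned to the printed data of [BPPTVY, Thm 7.1.3]: `S277` = the places of `ℚ` above
`{2, 277}`, `P277` = the places above the thirteen check primes `{3, 5, 7, …, 43}` =
`data277.checkPrimes` (`ParamodularCertificate.lean`, checked against print there), Euler factors in
the surface shape `1 − aT + bT² − paT³ + p²T⁴` ((4.1.5) p. 1164, (4.2.18) p. 1168).

## What is hypothesis and what is proved (cell pub-paramod, referee rulings A1/A2/A7/A8/S3/S10/S11)
The tree has no constructor for "the Jacobian of `y² + (x³+x²+x+1)y = −x²−x`" as an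
`AbelianVariety ℚ`, nor for the paramodular form `f₂₇₇` as a function on `ℍ₂`; both enter through
their defining data, exactly as in the generic assembly:
* `hFS` — the CITED criterion [BPPTVY, Thm 2.1.5 p. 1150 / Alg 2.4.1 pp. 1156–1157] as the named
  fact `traceEq_of_faltingsSerre_symplectic` (every hypothesis a binder; referee A2);
* `hC : Certificate277 J ν ρA ρf` — THE CERTIFICATE: the statement that the computed data discharge
  the binders of the criterion for the pair (`ρA`, `ρf`) with `S = S277`, `P = P277`.  It is a
  HYPOTHESIS of this theorem, not a Literature fact (ABSOLUTE RULE of the cell); its docstring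
  carries the canonical hash of the merged, twice-computed certificate file;
* `hframe`, `hA` — `ρA : Gal_ℚ → GL₄(ℤ₂)` frames the `2`-adic Tate module of `A` ((4.1.3) p. 1163)
  and `A` has good reduction at every `p ≠ 277` with `L_p(A,T) = 1 − aA p T + bA p T² − p aA p T³ +
  p² T⁴` ((4.1.4)–(4.1.5); "`cond A = 277`" is not a tree notion — this is where it enters);
* `hρf` — `ρf : Gal_ℚ → GL₄(ℤ₂)` is an integral form of `ρ_{f,2}`, PRESENTED IN `ρ̄A`'S FRAME (the
  certificate's `residual_eq` is equality, [BPPTVY] p. 1157 "we can assume ρ₁ ≡ ρ₂ (mod ℓ)"; one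
  `GL₄(ℤ₂)`-conjugation, Step 0 of the pipeline), with Frobenius polynomials
  `X⁴ Q_p(f,1/X)` at `p ∤ 2·277`: this is [BPPTVY, Thm 4.3.4 p. 1169] (Taylor, Laumon, Weissauer,
  Schmidt 2018, Mok 2014 — DEPENDS ON ARTHUR'S ENDOSCOPIC CLASSIFICATION for `GSp₄`, referee A7,
  cell pub-arthur; tree fact `BrumerEtAl2019.existsGaloisRep_weightTwo_primeLevel`) followed by the
  Carayol descent [Lemma 4.3.8(b) p. 1171] and the choice of a stable lattice — an INPUT here;
* `hcusp`, `hne`, `hfe` — `f ∈ S₂(K(277))`, `f ≢ 0`, with spinor Euler factors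
  `Q_p(f,T) = 1 − af p T + bf p T² − p af p T³ + p² T⁴` ((4.2.18)); `dim S₂(K(277)) = 1`
  (Poor–Yuen, Math. Comp. 84 (2015), cited in [BPPTVY, §6.2]) so any such `f` is `f₂₇₇` up to a
  scalar — not used by the proof;
* `h2` — `L_2(A,T) = Q_2(f,T)` coefficientwise: the prime `p = 2 = ℓ` is not decided by a `2`-adic
  comparison (cell DIVERGENCE.md D-4); it is certificate data (`verdict.checks."Q_p_equals_L_p_p<=7"`).
CONCLUSION `IsParamodularAwayFrom A 277 f`: `f` is a nonzero weight-2 paramodular cusp form of level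
`277` and `L_p(A,T) = Q_p(f,T)` for EVERY prime `p ≠ 277` ([BPPTVY, Thm 7.1.3] restricted to
`p ∤ N`; the factor at `p = 277` needs Thm 4.3.4(v)/Lemma 4.3.10 and is not certified here, D-4).
Nothing here says "modular (GL₄)" (referee S3).  PROVED, not assumed: the assembly itself
(`isParamodularAwayFrom_of_certificate`: conjugacy from the certificate via the tree's Carayol
theorem, uniqueness of Frobenius polynomials, `ℤ₂ ↪ ℚ₂` transport, `reverse`-injectivity), the
`data277` print checks and the `S₅(b)` signatures of `GSp4F2.lean` (`decide`).
`#print axioms paramodular_277` ⊆ {propext, Classical.choice, Quot.sound} (referee A8).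

PLACEMENT: referee ruling S11 names `Summits/Langlands/Langlands/Theorems/Paramodular277.lean`; the
gate refuses it for this unit (`perm.theorems-item`: Theorems files are route-directed and no
paramodular route/item exists; the cell opens no routes), so the instance lives next to the method
under `Literature/NumberTheory/FaltingsSerre/` — it is a reproduction of a PUBLISHED theorem
([BPPTVY, Thm 7.1.3]), which is Literature by the cell's placement rule (cell DIVERGENCE.md D-7/D-12).

## References
* [BPPTVY] ANT 13:5 (2019), Thm 7.1.3, Lemma 7.1.4 pp. 1187–1188; Thm 2.1.5 p. 1150; Alg 2.4.1
  p. 1156; (4.1.3)–(4.1.5) pp. 1163–1164; (4.2.18) p. 1168; Thm 4.3.4 p. 1169; Lemma 4.3.6 p. 1170; Lemma 4.3.8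
  p. 1171. [cite: BrumerEtAl2019]
-/

noncomputable section

namespace Literature.NumberTheory.FaltingsSerre.Paramodular277

open Polynomial IsDedekindDomain
open Literature.NumberTheory.FaltingsSerre Literature.NumberTheory.GaloisRepresentations
  Literature.NumberTheory.Automorphic.Paramodular Literature.NumberTheory.Automorphic
  Literature.AlgebraicGeometry.Motives
open scoped NumberField

/-- The places of `ℚ` lying above a finite set `T` of rational primes. [folklore] -/
def placesAbove (T : Finset ℕ) : Set (HeightOneSpectrum (𝓞 ℚ)) :=
  {v | ∃ q ∈ T, ((q : ℕ) : 𝓞 ℚ) ∈ v.asIdeal}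

/-- `S = {2, 277}` (and `∞`): the places above `2N`, outside which `ρ_{A,2}` and `ρ_{f,2}` are
unramified [BPPTVY, proof of Thm 7.1.3, p. 1187]. [cite: BrumerEtAl2019, Thm 7.1.3 p. 1187] -/
def S277 : Set (HeightOneSpectrum (𝓞 ℚ)) := placesAbove {2, 277}

/-- `P` = the places above the thirteen check primes `3, 5, 7, 11, 13, 17, 19, 23, 29, 31, 37, 41, 43`
of [BPPTVY, proof of Thm 7.1.3, p. 1188] (= `data277.checkPrimes`). [cite: BrumerEtAl2019, Thm 7.1.3 p. 1188] -/
def P277 : Set (HeightOneSpectrum (𝓞 ℚ)) := placesAbove data277.checkPrimes.toFinset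

/-- Print check: the level and the check primes are those of `data277`. [cite: BrumerEtAl2019, Thm 7.1.3 pp. 1187–1188] -/
theorem data277_conductor_checkPrimes :
    data277.conductor = 277 ∧
      data277.checkPrimes = [3, 5, 7, 11, 13, 17, 19, 23, 29, 31, 37, 41, 43] := by decide

/-- **The `N = 277` certificate, as a hypothesis.**  `Certificate277 J ν ρA ρf` says: the binders of
the Faltings–Serre criterion [BPPTVY, Thm 2.1.5 / Alg 2.4.1] hold for the framed `2`-adic
representations `ρA` (of `A`) and `ρf` (of `f₂₇₇`, in `ρ̄A`'s frame) with `S = S277`, `P = P277`,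
Gram matrix `J` and common multiplier `ν` — i.e. `Certificate S277 P277 J ν ρA ρf` of
`Literature/NumberTheory/FaltingsSerre/ParamodularCertificate.lean` (fields: `similitude₁₂`,
`det_isUnit`, `transpose_eq`, `diag_eq`, `unramified₁₂`, `absIrreducible`, `residual_eq`, `complete`,
`traces`).  It is DISCHARGED OUTSIDE THE KERNEL by the cell's merged certificate
`certs/277/certificate.canonical.json`, sha256
`34d2c59ac68941cd3c62e37f635b59d9841542e7b9f98dd8655a043277d83155`, every datum computed by two
independent implementations (lead A: pure python; lead B: PARI/GP 2.15.4; engineer-1 A: PARI +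
python cocycle enumeration, B: pure-python field arithmetic + GAP 4.12.1; engineer-2 E2a/E2b/B;
referee R audit run), GRH not assumed (`bnfcertify` ×2 and Minkowski-bound verification ×2):
`absIrreducible`/`residual_eq` ↦ blocks `residual` (image `S₅(b)`, `ℚ(A[2])` = splitting field of
`4x⁵ − 8x³ + 8x² − 4x + 1`, matched with `ρ̄_f`; the completeness of the Jones–Roberts table of
quintic/sextic fields unramified outside `{2, 277}` is CITED — JR14, LMS JCM 17 (2014), referee S10);
`complete` ↦ blocks `classfield` (`K₀` of degree 10, `4095` quadratic extensions), `group_theory`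
([BPPTVY, Thm 5.3.1, Lemma 5.1.7] tables recomputed ×2) and `obstructing` (`24062` pairs, final
`P` = the printed 13 primes); `traces` ↦ block `trace_check` (`a_p(A) = a_p(f)` at `P`, ≥ 2
recomputations each side); `unramified₁₂`, `similitude₁₂` ↦ (4.1.3) and Thm 4.3.4(ii).
Print data: [BPPTVY, Thm 7.1.3 and Lemma 7.1.4, pp. 1187–1188] = `data277`.
[cite: BrumerEtAl2019, Thm 7.1.3 and Lemma 7.1.4 pp. 1187–1188; Alg 2.4.1 p. 1156] -/
def Certificate277 (J : Matrix (Fin 4) (Fin 4) ℤ_[2]) (ν : Field.absoluteGaloisGroup ℚ → ℤ_[2])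
    (ρA ρf : FramedGaloisRep ℚ ℤ_[2] 4) : Prop :=
  Certificate S277 P277 J ν ρA ρf

/-- **Theorem 7.1.3 of [BPPTVY] for `p ∤ 277`, from the reproduced certificate.**
For an abelian surface `A/ℚ` whose `2`-adic Tate module is framed by `ρA` (`hframe`) and which has
good reduction with Euler factors `L_p(A,T) = 1 − aA p T + bA p T² − p aA p T³ + p²T⁴` at every
`p ≠ 277` (`hA`); an integral form `ρf` of `ρ_{f,2}` in `ρ̄A`'s frame with Frobenius polynomials
`X⁴Q_p(f,1/X)`, `Q_p(f,T) = 1 − af p T + bf p T² − p af p T³ + p²T⁴`, at `p ∤ 2·277` (`hρf`: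
[BPPTVY, Thm 4.3.4 — Arthur-dependent — + Lemma 4.3.8(b) p. 1171]); a nonzero `f ∈ S₂(K(277))` with these
spinor Euler factors (`hcusp`, `hne`, `hfe`); `L_2(A,T) = Q_2(f,T)` (`h2`); the cited criterion
(`hFS`) and the certificate (`hC`, sha256 `34d2c59a…3155`): `A` is paramodular of level `277` away
from `277` — `L_p(A,T) = Q_p(f,T)` for every prime `p ≠ 277`.
[cite: BrumerEtAl2019, Thm 7.1.3 p. 1187; Thm 2.1.5 p. 1150; Thm 4.3.4 p. 1169] -/
theorem paramodular_277 (hFS : traceEq_of_faltingsSerre_symplectic)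
    {A : AbelianVariety ℚ} {f : Matrix (Fin 2) (Fin 2) ℂ → ℂ}
    {ρA ρf : FramedGaloisRep ℚ ℤ_[2] 4} {J : Matrix (Fin 4) (Fin 4) ℤ_[2]}
    {ν : Field.absoluteGaloisGroup ℚ → ℤ_[2]}
    {b : Module.Basis (Fin 4) ℚ_[2] (A.rationalTateModule 2)}
    (hC : Certificate277 J ν ρA ρf)
    (hframe : A.IsFrameOfTateRep 2 b (rationalize ρA))
    (aA bA af bf : ℕ → ℤ)
    (hA : ∀ p : ℕ, p.Prime → ¬ p ∣ 277 →
      A.HasGoodEulerFactorAt p ((lPolynomialOfSurface p (aA p) (bA p)).map (Int.castRingHom ℚ)))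
    (hρf : ∀ p : ℕ, p.Prime → ¬ p ∣ 277 → p ≠ 2 →
      ∀ v : HeightOneSpectrum (𝓞 ℚ), ((p : ℕ) : 𝓞 ℚ) ∈ v.asIdeal →
        ρf.HasFrobCharpolyAt v
          ((lPolynomialOfSurface p (af p) (bf p)).reverse.map (Int.castRingHom ℤ_[2])))
    (hcusp : IsParamodularCuspForm 277 2 f) (hne : ∃ Z ∈ siegelUpperHalfSpace 2, f Z ≠ 0)
    (hfe : ∀ p : ℕ, p.Prime → ¬ p ∣ 277 →
      HasSpinorEulerFactorAt 2 p f ((lPolynomialOfSurface p (af p) (bf p)).map (Int.castRingHom ℂ)))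
    (h2 : aA 2 = af 2 ∧ bA 2 = bf 2) :
    IsParamodularAwayFrom A 277 f :=
  isParamodularAwayFrom_of_certificate hFS hC hframe
    (fun p => lPolynomialOfSurface p (aA p) (bA p)) (fun p => lPolynomialOfSurface p (af p) (bf p))
    (fun p => by rw [lPolynomialOfSurface_coeff_zero]; exact one_ne_zero)
    (fun p => by rw [lPolynomialOfSurface_coeff_zero]; exact one_ne_zero)
    hA hρf hcusp hne hfe (fun _ => by simp only [h2.1, h2.2])

/-- The conclusion unfolded at one prime: for every prime `p ≠ 277` there is ONE polynomial
`Q ∈ ℚ[T]` which is both the spinor Euler factor of `f` at `p` and the good Euler factor of `A` at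
`p` — "`L_p(A,T) = Q_p(f,T)`" [BPPTVY, Thm 7.1.3]. [cite: BrumerEtAl2019, Thm 7.1.3 p. 1187] -/
theorem eulerFactors_agree_277 {A : AbelianVariety ℚ} {f : Matrix (Fin 2) (Fin 2) ℂ → ℂ}
    (h : IsParamodularAwayFrom A 277 f) {p : ℕ} (hp : p.Prime) (hp' : p ≠ 277) :
    ∃ Q : Polynomial ℚ, HasSpinorEulerFactorAt 2 p f (Q.map (algebraMap ℚ ℂ)) ∧
      A.HasGoodEulerFactorAt p Q :=
  h.2.2 p hp (fun hdvd => hp' ((Nat.prime_dvd_prime_iff_eq hp (by norm_num)).mp hdvd))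

end Literature.NumberTheory.FaltingsSerre.Paramodular277
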